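import Literature.AlgebraicGeometry.Resolution.QuadraticTransformsStructure
import Literature.AlgebraicGeometry.Resolution.QuadraticTransformsUFD
import Literature.AlgebraicGeometry.Resolution.RegularLocalOrder
import Mathlib.RingTheory.Filtration
import HarnessLib

/-!
# [OURS · L1 W4.6 rung (i-a)] Thread chains, IV: the prime divisors of a two-dimensional regular local ring of `F` —
# the discrete valuation rings `S_{(π)} ⊆ F`, their maximality, and monomials in a regular system of parameters
# (cell res-hironaka, LADDER-RESOLUTION rung L, D-0089; campaign s46, prover res-L1-s46-pv-1; host route MarkedTransfer,
# `--supports stmt-ResolutionOfSingularities-16155`)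

HONEST FRAMING. Nothing here is a statement of H. Hironaka's manuscript (2017-03-23, [Hironaka2017]). Pure commutative
algebra inside a field `F`, used by the exceptional end game of the thread-chain proof of rung (i-a)
(`MarkedTransferCampaignW46ThreadChainExceptional.lean`): for a subring `S ⊆ F` which is a two-dimensional regular local
ring with fraction field `F` and a prime element `π`, the local ring `S_{(π)} ⊆ F` (Mathlib `LocalSubring.ofPrime`) is
the discrete valuation ring of the curve germ `π = 0`; we record its elementary behaviour. AI review is weaker than
expert review. No `sorry`; axioms standard.

## Contents

* `div_mem_ofPrime_span_iff` / `not_inv_mem_ofPrime_span_iff_dvd` — membership and units of `S_{(π)}` in terms of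
  divisibility by `π`; `ofPrime_span_ne_top`; `ofPrime_span_congr`.
* `eq_of_ofPrime_span_le` — **maximality**: a subring `T ≠ F` of `F` containing `S_{(π)}` equals it (a discrete
  valuation ring of `F` is a maximal proper subring).
* `exists_prime_span_eq_comap` — the centre on `S` of a prime `π'` of an over-ring `S' ⊇ S` inside `Frac S`: either it
  contains a given element `x`, or it is `(π₁)` for a prime `π₁` of `S` with `S_{(π₁)} ⊆ S'_{(π')}`.
* `exists_eq_unit_mul_pow_mul_pow` — in a unique factorization domain, an element all of whose prime divisors generate
  `(ξ)` or `(η)` is `ε ξ^α η^β`; `pow_mul_pow_not_mem_pow` — for a regular system of parameters `(ξ, η)` of a regular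
  local ring, `ξ^α η^β ∉ 𝔪^{α+β+1}`.

## References

* O. Zariski, P. Samuel, *Commutative Algebra* II (1960), Ch. VI §9–10, Appendix 5. [ZariskiSamuel1960]
* C. Huneke, I. Swanson, *Integral Closure of Ideals, Rings, and Modules* (2006), Ch. 14. [HunekeSwanson2006]
-/

noncomputable section

set_option linter.dupNamespace false -- mandated namespace of this single-conjunct summit

open IsLocalRing

namespace Summit.ResolutionOfSingularities.ResolutionOfSingularities.Theorems

namespace CampaignW46

open Literature.AlgebraicGeometry.Resolution

universe u

variable {F : Type u} [Field F]

/-! ## The local ring `S_{(π)}` of a prime element -/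

section OfPrimeSpan

variable {S : Subring F} {π : S}

/-- `(π)` is a prime ideal for a prime element `π` (instance form for `LocalSubring.ofPrime`). [folklore] -/
theorem isPrime_span_of_prime (hπ : Prime π) : (Ideal.span {π}).IsPrime :=
  (Ideal.span_singleton_prime hπ.ne_zero).mpr hπ

/-- **`y/π ∈ S_{(π)}` iff `π ∣ y`** (for `y ∈ S`). [folklore] -/
theorem div_mem_ofPrime_span_iff (hπ : Prime π) (y : S) :
    (haveI := isPrime_span_of_prime hπ; (y : F) / (π : F) ∈ (LocalSubring.ofPrime S (Ideal.span {π})).toSubring) ↔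
      π ∣ y := by
  haveI := isPrime_span_of_prime hπ
  have hπ0 : (π : F) ≠ 0 := fun e => hπ.ne_zero (Subtype.ext e)
  constructor
  · intro h
    obtain ⟨a, s, hs, he⟩ := mem_ofPrime_iff.mp h
    have hs0 : (s : F) ≠ 0 := coe_ne_zero_of_not_mem (K := F) hs
    have hys : y * s = π * a := by
      apply Subtype.ext
      simp only [Subring.coe_mul]
      rw [div_eq_div_iff hπ0 hs0] at he
      linear_combination he
    have hdvd : π ∣ y * s := ⟨a, hys⟩
    exact (hπ.dvd_or_dvd hdvd).resolve_right fun h => hs (Ideal.mem_span_singleton.mpr h)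
  · rintro ⟨c, rfl⟩
    rw [Subring.coe_mul, mul_div_cancel_left₀ _ hπ0]
    exact LocalSubring.le_ofPrime _ _ c.2

/-- **Units of `S_{(π)}`**: for a non-zero `z ∈ S`, `z⁻¹ ∉ S_{(π)}` iff `π ∣ z` (the centre of `S_{(π)}` on `S` is
`(π)`). [folklore] -/
theorem not_inv_mem_ofPrime_span_iff_dvd (hπ : Prime π) {z : S} (hz0 : z ≠ 0) :
    (haveI := isPrime_span_of_prime hπ; (z : F)⁻¹ ∉ (LocalSubring.ofPrime S (Ideal.span {π})).toSubring) ↔ π ∣ z := by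
  haveI := isPrime_span_of_prime hπ
  have hz0F : (z : F) ≠ 0 := fun e => hz0 (Subtype.ext e)
  constructor
  · intro h
    by_contra hnd
    exact h (by rw [inv_eq_one_div]; exact div_mem_ofPrime ⟨1, S.one_mem⟩ (fun hz => hnd (Ideal.mem_span_singleton.mp hz)))
  · rintro ⟨c, rfl⟩ hinv
    -- `1/(π c) ∈ S_{(π)}` gives `1/π = c · (π c)⁻¹ ∈ S_{(π)}`, i.e. `π ∣ 1`
    have h1 : ((1 : S) : F) / (π : F) ∈ (LocalSubring.ofPrime S (Ideal.span {π})).toSubring := by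
      have : ((1 : S) : F) / (π : F) = (c : F) * ((π * c : S) : F)⁻¹ := by
        have hπ0 : (π : F) ≠ 0 := fun e => hπ.ne_zero (Subtype.ext e)
        have hc0 : (c : F) ≠ 0 := by
          intro e; apply hz0; rw [show c = 0 from Subtype.ext e, mul_zero]
        rw [Subring.coe_mul, Subring.coe_one]; field_simp
      rw [this]
      exact Subring.mul_mem _ (LocalSubring.le_ofPrime _ _ c.2) hinv
    have := (div_mem_ofPrime_span_iff hπ 1).mp h1
    exact hπ.not_unit (isUnit_of_dvd_one this)

/-- `S_{(π)} ≠ F`: `π⁻¹ ∉ S_{(π)}`. [folklore] -/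
theorem inv_not_mem_ofPrime_span (hπ : Prime π) :
    haveI := isPrime_span_of_prime hπ; (π : F)⁻¹ ∉ (LocalSubring.ofPrime S (Ideal.span {π})).toSubring :=
  (not_inv_mem_ofPrime_span_iff_dvd hπ hπ.ne_zero).mpr dvd_rfl

/-- `S_{(π)}` depends only on the ideal `(π)`. [folklore] -/
theorem ofPrime_span_congr {π π' : S} (hπ : Prime π) (hπ' : Prime π') (h : Ideal.span {π} = Ideal.span {π'}) :
    (haveI := isPrime_span_of_prime hπ; (LocalSubring.ofPrime S (Ideal.span {π})).toSubring) =
      (haveI := isPrime_span_of_prime hπ'; (LocalSubring.ofPrime S (Ideal.span {π'})).toSubring) := by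
  haveI := isPrime_span_of_prime hπ
  haveI := isPrime_span_of_prime hπ'
  ext z
  rw [mem_ofPrime_iff, mem_ofPrime_iff]
  simp only [h]

/-- **Maximality of `S_{(π)}`** (for `S` Noetherian with fraction field `F`): a subring `T ≠ F` of `F` containing
`S_{(π)}` equals it — every element of `F` is `π^{±n} ·` (unit of `S_{(π)}`) and `π⁻¹ ∈ T` would give `T = F`.
[cite: ZariskiSamuel1960, Ch. VI §10] -/
theorem eq_of_ofPrime_span_le [IsNoetherianRing S] (hπ : Prime π)
    (hS : ∀ z : F, ∃ a ∈ S, ∃ b ∈ S, b ≠ 0 ∧ z = a / b) {T : Subring F}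
    (hle : haveI := isPrime_span_of_prime hπ; (LocalSubring.ofPrime S (Ideal.span {π})).toSubring ≤ T)
    {t : F} (ht : t ∉ T) :
    T = (haveI := isPrime_span_of_prime hπ; (LocalSubring.ofPrime S (Ideal.span {π})).toSubring) := by
  haveI := isPrime_span_of_prime hπ
  set V := (LocalSubring.ofPrime S (Ideal.span {π})).toSubring with hV
  haveI : IsNoetherianRing V := isNoetherianRing_ofPrime
  have hval := mem_or_inv_mem_ofPrime_of_span_singleton (P := Ideal.span {π}) (π := π) rfl hS
  have hπ0 : (π : F) ≠ 0 := fun e => hπ.ne_zero (Subtype.ext e)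
  refine le_antisymm (fun z hz => ?_) hle
  by_contra hzV
  -- `z⁻¹ = π w` with `w ∈ V`, so `π⁻¹ = w z ∈ T`
  have hz0 : z ≠ 0 := by rintro rfl; exact hzV V.zero_mem
  have hzi : z⁻¹ ∈ V := (hval z).resolve_left hzV
  obtain ⟨w, hw, hzw⟩ := exists_eq_mul_of_inv_not_mem_ofPrime (P := Ideal.span {π}) (π := π) rfl hzi
    (by rwa [inv_inv])
  have hπinv : (π : F)⁻¹ ∈ T := by
    have h1 : (π : F) * (w * z) = 1 := by rw [← mul_assoc, ← hzw, inv_mul_cancel₀ hz0]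
    rw [inv_eq_of_mul_eq_one_right h1]
    exact T.mul_mem (hle hw) hz
  -- then every `f ∈ F` lies in `T`: `f ∈ V` or `f⁻¹ = π^n c` with `c` a unit of `V`
  apply ht
  rcases hval t with htV | htV
  · exact hle htV
  · by_cases ht0 : t = 0
    · rw [ht0]; exact T.zero_mem
    -- Krull: `t⁻¹ ∉ ⋂ (π^n) V`
    have hKrull : (⨅ n : ℕ, (maximalIdeal V) ^ n) = ⊥ :=
      Ideal.iInf_pow_eq_bot_of_isLocalRing _ (maximalIdeal.isMaximal V).ne_top
    have hmax : ∀ y : V, y ∈ maximalIdeal V ↔ ∃ w : V, (y : F) = π * w := by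
      intro y
      rw [mem_maximalIdeal_iff_inv_not_mem]
      constructor
      · rintro (h0 | hni)
        · exact ⟨0, by simp [h0]⟩
        · obtain ⟨w, hw, e⟩ := exists_eq_mul_of_inv_not_mem_ofPrime (P := Ideal.span {π}) (π := π) rfl y.2 hni
          exact ⟨⟨w, hw⟩, e⟩
      · rintro ⟨w, hw⟩
        by_cases hy0 : (y : F) = 0
        · exact Or.inl hy0
        · right
          intro hinv
          -- `π⁻¹ = w · y⁻¹ ∈ V`
          apply inv_not_mem_ofPrime_span hπ
          have hw0 : (w : F) ≠ 0 := by
            intro e; rw [e, mul_zero] at hw; exact hy0 hw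
          have : (π : F)⁻¹ = (w : F) * (y : F)⁻¹ := by rw [hw]; field_simp
          change (π : F)⁻¹ ∈ V
          rw [this]; exact V.mul_mem w.2 hinv
    -- find `n` with `t⁻¹ ∈ 𝔪^n ∖ 𝔪^(n+1)`
    have hex : ∃ n : ℕ, (⟨t⁻¹, htV⟩ : V) ∉ maximalIdeal V ^ (n + 1) := by
      by_contra hall
      push Not at hall
      have hmem : (⟨t⁻¹, htV⟩ : V) ∈ ⨅ n : ℕ, (maximalIdeal V) ^ n := by
        rw [Ideal.mem_iInf]
        intro n
        cases n with
        | zero => rw [pow_zero, Ideal.one_eq_top]; trivial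
        | succ n => exact hall n
      rw [hKrull, Ideal.mem_bot] at hmem
      exact inv_ne_zero ht0 (congrArg Subtype.val hmem)
    classical
    obtain ⟨n, hn, hmin⟩ : ∃ n, (⟨t⁻¹, htV⟩ : V) ∉ maximalIdeal V ^ (n + 1) ∧
        ∀ m, m < n → ¬ (⟨t⁻¹, htV⟩ : V) ∉ maximalIdeal V ^ (m + 1) :=
      ⟨Nat.find hex, Nat.find_spec hex, fun m hm => Nat.find_min hex hm⟩
    have hn' : (⟨t⁻¹, htV⟩ : V) ∈ maximalIdeal V ^ n := by
      cases hn0 : n with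
      | zero => rw [pow_zero, Ideal.one_eq_top]; trivial
      | succ m =>
        have := hmin m (by rw [hn0]; exact Nat.lt_succ_self m)
        push Not at this
        exact this
    -- `𝔪^n = (π^n)`: write `t⁻¹ = π^n c`
    have hmπ : maximalIdeal V = Ideal.span {(⟨(π : F), LocalSubring.le_ofPrime _ _ π.2⟩ : V)} := by
      ext y
      rw [hmax y, Ideal.mem_span_singleton']
      constructor
      · rintro ⟨w, hw⟩; exact ⟨w, Subtype.ext (by rw [Subring.coe_mul, mul_comm]; exact hw.symm)⟩
      · rintro ⟨w, hw⟩; exact ⟨w, by rw [← hw, Subring.coe_mul, mul_comm]⟩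
    rw [hmπ, Ideal.span_singleton_pow, Ideal.mem_span_singleton'] at hn hn'
    obtain ⟨c, hc⟩ := hn'
    have hcunit : (c : F)⁻¹ ∈ V := by
      by_contra hci
      obtain ⟨w, hw, hcw⟩ := exists_eq_mul_of_inv_not_mem_ofPrime (P := Ideal.span {π}) (π := π) rfl c.2 hci
      apply hn
      refine ⟨⟨w, hw⟩, Subtype.ext ?_⟩
      have e := congrArg Subtype.val hc
      simp only [Subring.coe_mul, SubmonoidClass.coe_pow] at e ⊢
      rw [← e, hcw]; ring
    have htinv : t = (c : F)⁻¹ * ((π : F)⁻¹) ^ n := by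
      have e := congrArg Subtype.val hc
      simp only [Subring.coe_mul, SubmonoidClass.coe_pow] at e
      -- e : c * π^n = t⁻¹
      have hc0 : (c : F) ≠ 0 := by
        intro h0; rw [h0, zero_mul] at e; exact inv_ne_zero ht0 e.symm
      rw [inv_pow, ← mul_inv, e, inv_inv]
    rw [htinv]
    exact T.mul_mem (hle hcunit) (T.pow_mem hπinv n)

end OfPrimeSpan

/-! ## The centre of a prime of an over-ring -/

/-- **The centre on `S` of a prime element `π'` of an over-ring `S' ⊇ S` inside `Frac S`**, `S` a two-dimensional regular
local ring: the ideal `{z ∈ S | π' ∣ z in S'}` is a non-zero prime; if it misses an element `x ∈ 𝔪_S` it is `(π₁)` for a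
prime element `π₁` of `S`, and then `S_{(π₁)} ⊆ S'_{(π')}`. [cite: ZariskiSamuel1960, Appendix 5] -/
theorem exists_prime_span_eq_comap {S S' : Subring F} [IsRegularLocalRing S] (hdim : ringKrullDim S = 2)
    (hS : ∀ z : F, ∃ a ∈ S, ∃ b ∈ S, b ≠ 0 ∧ z = a / b) (hle : S ≤ S') {π' : S'} (hπ' : Prime π')
    {x : S} (hxm : x ∈ maximalIdeal S) (hx : ¬ π' ∣ Subring.inclusion hle x) :
    ∃ (π₁ : S) (hπ₁ : Prime π₁), (Ideal.span {π'}).comap (Subring.inclusion hle) = Ideal.span {π₁} ∧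
      (haveI := isPrime_span_of_prime hπ₁; haveI := isPrime_span_of_prime hπ';
        (LocalSubring.ofPrime S (Ideal.span {π₁})).toSubring ≤ (LocalSubring.ofPrime S' (Ideal.span {π'})).toSubring) := by
  haveI := isPrime_span_of_prime hπ'
  set c : Ideal S := (Ideal.span {π'}).comap (Subring.inclusion hle) with hc
  haveI : c.IsPrime := Ideal.comap_isPrime _ _
  have hcm : c ≠ maximalIdeal S := by
    intro h
    have : x ∈ c := h ▸ hxm
    rw [hc, Ideal.mem_comap, Ideal.mem_span_singleton] at this
    exact hx this
  obtain ⟨π₁, hπ₁⟩ := exists_eq_span_singleton_of_ne_maximalIdeal hdim c hcm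
  -- `c ≠ 0`: `π' = a / s` with `a, s ∈ S`, and `a = π' s ∈ c`
  have hc0 : c ≠ ⊥ := by
    obtain ⟨a, ha, s, hs, hs0, he⟩ := hS (π' : F)
    intro hbot
    have hamem : (⟨a, ha⟩ : S) ∈ c := by
      rw [hc, Ideal.mem_comap, Ideal.mem_span_singleton]
      refine ⟨⟨s, hle hs⟩, Subtype.ext ?_⟩
      change a = (π' : F) * s
      rw [he, div_mul_cancel₀ _ hs0]
    rw [hbot, Ideal.mem_bot] at hamem
    have ha0 : a = 0 := congrArg Subtype.val hamem
    apply hπ'.ne_zero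
    apply Subtype.ext
    change (π' : F) = 0
    rw [he, ha0, zero_div]
  have hπ₁0 : π₁ ≠ 0 := by rintro rfl; exact hc0 (hπ₁.trans (by simp))
  have hπ₁p : Prime π₁ := (Ideal.span_singleton_prime hπ₁0).mp (hπ₁ ▸ inferInstance)
  haveI := isPrime_span_of_prime hπ₁p
  refine ⟨π₁, hπ₁p, hπ₁, fun z hz => ?_⟩
  obtain ⟨a, s, hs, rfl⟩ := mem_ofPrime_iff.mp hz
  rw [mem_ofPrime_iff]
  refine ⟨Subring.inclusion hle a, Subring.inclusion hle s, fun hs' => hs ?_, rfl⟩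
  rw [← hπ₁]
  rw [hc, Ideal.mem_comap]
  exact hs'

/-! ## Monomials in a regular system of parameters -/

/-- **In a unique factorization domain, an element all of whose prime divisors generate `(ξ)` or `(η)` is
`ε ξ^α η^β`** with `ε` a unit. [folklore] -/
theorem exists_eq_unit_mul_pow_mul_pow {D : Type*} [CommRing D] [IsDomain D] [UniqueFactorizationMonoid D]
    {ξ η : D} {u : D} (hu0 : u ≠ 0)
    (h : ∀ π : D, Prime π → π ∣ u → Ideal.span {π} = Ideal.span {ξ} ∨ Ideal.span {π} = Ideal.span {η}) :
    ∃ (α β : ℕ) (ε : Dˣ), u = ε * ξ ^ α * η ^ β := by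
  classical
  induction u using UniqueFactorizationMonoid.induction_on_prime with
  | h₁ => exact absurd rfl hu0
  | h₂ v hv => exact ⟨0, 0, hv.unit, by simp⟩
  | h₃ a p ha0 hp ih =>
    have ha : ∀ π : D, Prime π → π ∣ a → Ideal.span {π} = Ideal.span {ξ} ∨ Ideal.span {π} = Ideal.span {η} :=
      fun π hπ hπa => h π hπ (hπa.mul_left p)
    obtain ⟨α, β, ε, rfl⟩ := ih ha0 ha
    rcases h p hp (dvd_mul_right p _) with hpξ | hpη
    · obtain ⟨w, hw⟩ := Ideal.mem_span_singleton'.mp (hpξ ▸ Ideal.mem_span_singleton_self p : p ∈ Ideal.span {ξ})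
      obtain ⟨w', hw'⟩ := Ideal.mem_span_singleton'.mp (hpξ.symm ▸ Ideal.mem_span_singleton_self ξ : ξ ∈ Ideal.span {p})
      have hξ0 : ξ ≠ 0 := by rintro rfl; rw [mul_zero] at hw; exact hp.ne_zero hw.symm
      have hwu : IsUnit w := by
        refine isUnit_iff_exists_inv.mpr ⟨w', mul_left_cancel₀ hξ0 ?_⟩
        calc ξ * (w * w') = w' * (w * ξ) := by ring
          _ = ξ := by rw [hw, hw']
          _ = ξ * 1 := (mul_one ξ).symm
      refine ⟨α + 1, β, hwu.unit * ε, ?_⟩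
      rw [Units.val_mul, IsUnit.unit_spec, ← hw]; ring
    · obtain ⟨w, hw⟩ := Ideal.mem_span_singleton'.mp (hpη ▸ Ideal.mem_span_singleton_self p : p ∈ Ideal.span {η})
      obtain ⟨w', hw'⟩ := Ideal.mem_span_singleton'.mp (hpη.symm ▸ Ideal.mem_span_singleton_self η : η ∈ Ideal.span {p})
      have hη0 : η ≠ 0 := by rintro rfl; rw [mul_zero] at hw; exact hp.ne_zero hw.symm
      have hwu : IsUnit w := by
        refine isUnit_iff_exists_inv.mpr ⟨w', mul_left_cancel₀ hη0 ?_⟩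
        calc η * (w * w') = w' * (w * η) := by ring
          _ = η := by rw [hw, hw']
          _ = η * 1 := (mul_one η).symm
      refine ⟨α, β + 1, hwu.unit * ε, ?_⟩
      rw [Units.val_mul, IsUnit.unit_spec, ← hw]; ring

/-- **`ξ^α η^β ∉ 𝔪^{α+β+1}`** for elements `ξ, η ∉ 𝔪²` of a regular local ring (the order is additive, tree
`RegularLocalOrder.lean`), and the same with a unit factor. [folklore] -/
theorem unit_mul_pow_mul_pow_not_mem_pow {A : Type*} [CommRing A] [IsRegularLocalRing A] {ξ η : A}
    (hξ : ξ ∉ maximalIdeal A ^ 2) (hη : η ∉ maximalIdeal A ^ 2) (ε : Aˣ) (α β : ℕ) :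
    (ε : A) * ξ ^ α * η ^ β ∉ maximalIdeal A ^ (α + β + 1) := by
  have h1 : ξ ^ α * η ^ β ∉ maximalIdeal A ^ (α + β + 1) := by
    have ha : ξ ^ α ∉ maximalIdeal A ^ (α + 1) := by
      have := pow_not_mem_pow_of_not_mem_pow hξ α; rwa [mul_one] at this
    have hb : η ^ β ∉ maximalIdeal A ^ (β + 1) := by
      have := pow_not_mem_pow_of_not_mem_pow hη β; rwa [mul_one] at this
    exact mul_not_mem_pow_of_not_mem_pow ha hb
  intro h
  apply h1
  rw [mul_assoc] at h
  exact (Ideal.unit_mul_mem_iff_mem _ ε.isUnit).mp h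

end CampaignW46

end Summit.ResolutionOfSingularities.ResolutionOfSingularities.Theorems

end
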